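import Summits.SmoothPoincare4.SmoothPoincare4.Theorems.DottedCircleRasmussenDcrGapHelperHandlebodyChartModelHandlesProfiles

/-!
# Helper `helper_handlebodyChart_modelHandles` (M3: handle structure of the model dotted handlebody `D_k`)
# of line `mk_friends` for crux `DcrGap` — handle charts, part 2: the planar tube map
(item stmt-SmoothPoincare4-16128, route route-SmoothPoincare4-DottedCircleRasmussen)

Towards the registered stub `helper_handlebodyChart_modelHandles_data_part1`.  With the profiles `R`, `S` of
`…ModelHandlesProfiles.lean` and the affine width `b(p₁) = (793 + 95 p₁)/500`, the **planar tube map** of a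
handle is `τ(p₀, p₁) = (R(p₀) + b(p₁) sin(π S(p₀)), -b(p₁) cos(π S(p₀)))` (the coordinates `(r, m)` = distance
from the base centre, lateral offset at the hole).  This file proves, for abstract profiles with the properties
of `ModelHandles.exists_tube_profiles`:

* `ModelHandles.tube_injective`: `τ` is injective on `(-2, 2) × (-2, 2)` (a monotonicity case analysis: the
  sign of `cos(π S)` separates the two legs, on each side `r` increases along the core and the nested
  half-ellipses of different widths are disjoint);
* `ModelHandles.tube_kernel_trivial`: the `2 × 2` Jacobian of `τ` has trivial kernel wherever
  `R' cos(π S) + b π S' > 0`;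
* `ModelHandles.tube_regimes`: on the box `|p₀|, |p₁| < 101/100` the width is in `(1.39, 1.78)`, `r > 0`,
  `r = a(2 - |p₀|)` for `|p₀| ≥ 1/2`, `r ≥ 3a/2` for `|p₀| ≤ 1/2`, and either (legs, `|p₀| ≥ 1/5`)
  `sin(π S) = 0`, `cos(π S) = ±1`, `r = R ≤ V`, or (bend) `V - 1/250 ≤ R ≤ V`.

Registered summary `helper_handlebodyChart_modelHandles_planarTube`.  No definitions, no named facts, no `sorry`.
References: R. Kirby, *The Topology of 4-Manifolds*, LNM 1374 (1989), Ch. I §2 [Kirby1989].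
-/

-- the prescribed namespace `Summit.<P>.<Sub>.…` duplicates `SmoothPoincare4` (P = Sub)
set_option linter.dupNamespace false
set_option linter.style.longLine false
noncomputable section

open Set Filter Real
open scoped Topology ContDiff

namespace Summit.SmoothPoincare4.SmoothPoincare4.Theorems.DcrGap.MkFriends

namespace ModelHandles

/-! ## The bend profile is monotone; trigonometry of `π S` -/

/-- A smooth step (`0` before `-1/5`, `1 - S(-t)` symmetry, strictly increasing on `[-1/5, 1/5]`) is monotone,
and `= 1` after `1/5`. [folklore] -/
theorem step_monotone {S : ℝ → ℝ} (h0 : ∀ t, t ≤ -1 / 5 → S t = 0) (hsymm : ∀ t, S (-t) = 1 - S t)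
    (hmono : StrictMonoOn S (Icc (-1 / 5) (1 / 5))) : Monotone S ∧ ∀ t, 1 / 5 ≤ t → S t = 1 := by
  have h1 : ∀ t, 1 / 5 ≤ t → S t = 1 := fun t ht => by
    have h := hsymm t; rw [h0 (-t) (by linarith)] at h; linarith
  refine ⟨fun s t hst => ?_, h1⟩
  rcases le_or_gt s (-1 / 5) with hs | hs
  · rw [h0 s hs]
    rcases le_or_gt t (-1 / 5) with ht | ht
    · rw [h0 t ht]
    · rcases le_or_gt t (1 / 5) with ht' | ht'
      · have := hmono.monotoneOn ⟨le_rfl, by norm_num⟩ ⟨ht.le, ht'⟩ ht.le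
        rwa [h0 _ le_rfl] at this
      · rw [h1 t ht'.le]; norm_num
  · rcases le_or_gt t (1 / 5) with ht' | ht'
    · exact hmono.monotoneOn ⟨hs.le, by linarith⟩ ⟨by linarith, ht'⟩ hst
    · rw [h1 t ht'.le]
      rcases le_or_gt s (1 / 5) with hs' | hs'
      · have := hmono.monotoneOn ⟨hs.le, hs'⟩ ⟨by norm_num, le_rfl⟩ hs'
        rwa [h1 _ le_rfl] at this
      · rw [h1 s hs'.le]

/-- For `u ∈ [0, 1]`: `cos(π u) > 0 ↔ u < 1/2`, `cos(π u) < 0 ↔ 1/2 < u`, `cos(π u) = 0 ↔ u = 1/2`, and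
`0 ≤ sin(π u)`. [folklore] -/
theorem cos_pi_mul_sign {u : ℝ} (hu0 : 0 ≤ u) (hu1 : u ≤ 1) :
    (0 < cos (π * u) ↔ u < 1 / 2) ∧ (cos (π * u) < 0 ↔ 1 / 2 < u) ∧ (cos (π * u) = 0 ↔ u = 1 / 2) ∧
      0 ≤ sin (π * u) := by
  have hπ := pi_pos
  have hmem : π * u ∈ Icc 0 π := ⟨by positivity, by nlinarith⟩
  have hhalf : π * (1 / 2) ∈ Icc 0 π := ⟨by positivity, by nlinarith⟩
  have hcos_half : cos (π * (1 / 2)) = 0 := by rw [show π * (1 / 2) = π / 2 by ring, cos_pi_div_two]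
  have hlt : 0 < cos (π * u) ↔ u < 1 / 2 := by
    rw [← hcos_half, StrictAntiOn.lt_iff_gt Real.strictAntiOn_cos hhalf hmem]
    constructor
    · intro h; nlinarith
    · intro h; nlinarith
  have hgt : cos (π * u) < 0 ↔ 1 / 2 < u := by
    rw [← hcos_half, StrictAntiOn.lt_iff_gt Real.strictAntiOn_cos hmem hhalf]
    constructor
    · intro h; nlinarith
    · intro h; nlinarith
  refine ⟨hlt, hgt, ⟨fun h => ?_, fun h => by rw [h, hcos_half]⟩, sin_nonneg_of_nonneg_of_le_pi hmem.1 hmem.2⟩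
  rcases lt_trichotomy u (1 / 2) with h' | h' | h'
  · have := hlt.2 h'; linarith
  · exact h'
  · have := hgt.2 h'; linarith

/-! ## Injectivity of the planar tube map -/

/-- The lower-leg half of injectivity: if both points have `cos(π S) > 0` (so lie before the apex) and the
widths are ordered, equal images force equal parameters. [folklore] -/
theorem tube_injective_aux {R S b : ℝ → ℝ} (hSmono' : Monotone S) (hS01 : ∀ t, 0 ≤ S t ∧ S t ≤ 1)
    (hRmono : StrictMonoOn R (Icc (-2) 0)) (hlt : ∀ t, S t < 1 / 2 ↔ t < 0) (hb : StrictMono b)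
    {t t' p p' : ℝ} (ht : t ∈ Ioo (-2 : ℝ) 2) (ht' : t' ∈ Ioo (-2 : ℝ) 2)
    (hbp : 0 < b p) (hpp : p ≤ p')
    (hc : 0 < cos (π * S t)) (hc' : 0 < cos (π * S t'))
    (hr : R t + b p * sin (π * S t) = R t' + b p' * sin (π * S t'))
    (hm : b p * cos (π * S t) = b p' * cos (π * S t')) : t = t' ∧ p = p' := by
  have hπ := pi_pos
  obtain ⟨hclt, -, -, hsin⟩ := cos_pi_mul_sign (hS01 t).1 (hS01 t).2
  obtain ⟨hclt', -, -, hsin'⟩ := cos_pi_mul_sign (hS01 t').1 (hS01 t').2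
  have htneg : t < 0 := (hlt t).1 (hclt.1 hc)
  have htneg' : t' < 0 := (hlt t').1 (hclt'.1 hc')
  have hbp' : b p ≤ b p' := hb.monotone hpp
  -- the angles lie in `[0, π/2)`
  have hθ : π * S t ∈ Icc 0 π := ⟨by nlinarith [(hS01 t).1], by nlinarith [(hS01 t).2]⟩
  have hθ' : π * S t' ∈ Icc 0 π := ⟨by nlinarith [(hS01 t').1], by nlinarith [(hS01 t').2]⟩
  -- `cos θ ≥ cos θ'`, so `θ ≤ θ'`
  have hcos_le : cos (π * S t') ≤ cos (π * S t) := by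
    by_contra h
    push Not at h
    have : b p * cos (π * S t) < b p' * cos (π * S t') :=
      calc b p * cos (π * S t) < b p * cos (π * S t') := by gcongr
        _ ≤ b p' * cos (π * S t') := by gcongr
    linarith
  have hθle : π * S t ≤ π * S t' := (StrictAntiOn.le_iff_ge Real.strictAntiOn_cos hθ' hθ).1 hcos_le
  have hSle : S t ≤ S t' := by nlinarith
  -- `sin θ ≤ sin θ'` (both angles are `< π/2`)
  have hlt2 : S t < 1 / 2 := hclt.1 hc
  have hlt2' : S t' < 1 / 2 := hclt'.1 hc'
  have hsin_le : sin (π * S t) ≤ sin (π * S t') :=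
    StrictMonoOn.monotoneOn Real.strictMonoOn_sin ⟨by linarith [hθ.1], by nlinarith⟩ ⟨by linarith [hθ'.1], by nlinarith⟩ hθle
  -- hence `R t ≥ R t'`, so `t ≥ t'`, so `S t = S t'`
  have hRge : R t' ≤ R t := by
    have h1 : b p * sin (π * S t) ≤ b p' * sin (π * S t') :=
      calc b p * sin (π * S t) ≤ b p' * sin (π * S t) := by gcongr
        _ ≤ b p' * sin (π * S t') := by gcongr; linarith
    linarith
  have htt : t' ≤ t := (hRmono.le_iff_le ⟨ht'.1.le, htneg'.le⟩ ⟨ht.1.le, htneg.le⟩).1 hRge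
  have hSeq : S t = S t' := le_antisymm hSle (hSmono' htt)
  rw [hSeq] at hm hr
  have hbeq : b p = b p' := by
    have := mul_right_cancel₀ hc'.ne' hm
    exact this
  have hpeq : p = p' := hb.injective hbeq
  rw [hbeq] at hr
  have hReq : R t = R t' := by linarith
  exact ⟨hRmono.injOn ⟨ht.1.le, htneg.le⟩ ⟨ht'.1.le, htneg'.le⟩ hReq, hpeq⟩

/-- **The planar tube map is injective** on `(-2, 2) × (-2, 2)`: for profiles `R` (even, strictly increasing
on `[-2, 0]`), `S` (a step from `0` to `1` on `[-1/5, 1/5]`, `S(-t) = 1 - S(t)`) and a positive strictly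
increasing width `b`, equal values of `(R + b sin(π S), b cos(π S))` force equal parameters. [folklore] -/
theorem tube_injective {R S b : ℝ → ℝ} (hReven : ∀ t, R (-t) = R t) (hRmono : StrictMonoOn R (Icc (-2) 0))
    (hS0 : ∀ t, t ≤ -1 / 5 → S t = 0) (hSsymm : ∀ t, S (-t) = 1 - S t)
    (hSmono : StrictMonoOn S (Icc (-1 / 5) (1 / 5))) (hS01 : ∀ t, 0 ≤ S t ∧ S t ≤ 1)
    (hb : StrictMono b) (hbpos : ∀ p, -2 < p → 0 < b p)
    {t t' p p' : ℝ} (ht : t ∈ Ioo (-2 : ℝ) 2) (ht' : t' ∈ Ioo (-2 : ℝ) 2) (hp : p ∈ Ioo (-2 : ℝ) 2)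
    (hp' : p' ∈ Ioo (-2 : ℝ) 2)
    (hr : R t + b p * sin (π * S t) = R t' + b p' * sin (π * S t'))
    (hm : b p * cos (π * S t) = b p' * cos (π * S t')) : t = t' ∧ p = p' := by
  have hπ := pi_pos
  obtain ⟨hSmono', -⟩ := step_monotone hS0 hSsymm hSmono
  obtain ⟨-, hlt, -, heq⟩ := profS_half hS0 hSsymm hSmono
  have hbp := hbpos p hp.1
  have hbp' := hbpos p' hp'.1
  obtain ⟨hclt, hcgt, hc0, -⟩ := cos_pi_mul_sign (hS01 t).1 (hS01 t).2
  obtain ⟨hclt', hcgt', hc0', -⟩ := cos_pi_mul_sign (hS01 t').1 (hS01 t').2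
  -- the key reduction, symmetric in the two points
  have key : ∀ {t t' p p' : ℝ}, t ∈ Ioo (-2 : ℝ) 2 → t' ∈ Ioo (-2 : ℝ) 2 → 0 < b p → 0 < b p' →
      0 < cos (π * S t) → 0 < cos (π * S t') →
      R t + b p * sin (π * S t) = R t' + b p' * sin (π * S t') →
      b p * cos (π * S t) = b p' * cos (π * S t') → t = t' ∧ p = p' := by
    intro t t' p p' ht ht' hbp hbp' hc hc' hr hm
    rcases le_total p p' with hpp | hpp
    · exact tube_injective_aux hSmono' hS01 hRmono hlt hb ht ht' hbp hpp hc hc' hr hm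
    · obtain ⟨h1, h2⟩ := tube_injective_aux hSmono' hS01 hRmono hlt hb ht' ht hbp' hpp hc' hc hr.symm hm.symm
      exact ⟨h1.symm, h2.symm⟩
  rcases lt_trichotomy (cos (π * S t)) 0 with hc | hc | hc
  · -- both beyond the apex: reflect `t ↦ -t`
    have hc' : cos (π * S t') < 0 := by
      by_contra h; push Not at h
      have h1 : b p * cos (π * S t) < 0 := mul_neg_of_pos_of_neg hbp hc
      have h2 : 0 ≤ b p' * cos (π * S t') := mul_nonneg hbp'.le h
      linarith
    have hcn : 0 < cos (π * S (-t)) := by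
      rw [hSsymm, mul_sub, mul_one, cos_pi_sub]; linarith
    have hcn' : 0 < cos (π * S (-t')) := by
      rw [hSsymm, mul_sub, mul_one, cos_pi_sub]; linarith
    have hrn : R (-t) + b p * sin (π * S (-t)) = R (-t') + b p' * sin (π * S (-t')) := by
      rw [hReven, hReven, hSsymm, hSsymm, mul_sub, mul_sub, mul_one, sin_pi_sub, sin_pi_sub]; exact hr
    have hmn : b p * cos (π * S (-t)) = b p' * cos (π * S (-t')) := by
      rw [hSsymm, hSsymm, mul_sub, mul_sub, mul_one, cos_pi_sub, cos_pi_sub]; linarith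
    obtain ⟨h1, h2⟩ := key (t := -t) (t' := -t') ⟨by linarith [ht.2], by linarith [ht.1]⟩
      ⟨by linarith [ht'.2], by linarith [ht'.1]⟩ hbp hbp' hcn hcn' hrn hmn
    exact ⟨by linarith, h2⟩
  · -- at the apex
    have hc' : cos (π * S t') = 0 := by
      have : b p' * cos (π * S t') = 0 := by rw [← hm, hc, mul_zero]
      rcases mul_eq_zero.1 this with h | h
      · linarith
      · exact h
    have ht0 : t = 0 := (heq t).1 (hc0.1 hc)
    have ht0' : t' = 0 := (heq t').1 (hc0'.1 hc')
    subst ht0 ht0'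
    refine ⟨rfl, hb.injective ?_⟩
    have hS0' : S 0 = 1 / 2 := (heq 0).2 rfl
    rw [hS0', show π * (1 / 2) = π / 2 by ring, sin_pi_div_two, mul_one, mul_one] at hr
    linarith
  · have hc' : 0 < cos (π * S t') := by
      by_contra h; push Not at h
      have h1 : 0 < b p * cos (π * S t) := mul_pos hbp hc
      have h2 : b p' * cos (π * S t') ≤ 0 := mul_nonpos_of_nonneg_of_nonpos hbp'.le h
      linarith
    exact key ht ht' hbp hbp' hc hc' hr hm

/-! ## The Jacobian has trivial kernel -/

/-- **Trivial kernel of the Jacobian of the tube map**: with `θ = π S`, the system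
`(R' + b π S' cos θ) v₀ + b' sin θ v₁ = 0`, `b π S' sin θ v₀ - b' cos θ v₁ = 0` has only the zero solution
when `R' cos θ + b π S' > 0` and `b' ≠ 0`. [folklore] -/
theorem tube_kernel_trivial {R' S' b b' θ v₀ v₁ : ℝ} (hD : 0 < R' * cos θ + b * π * S') (hb' : b' ≠ 0)
    (h1 : (R' + b * π * S' * cos θ) * v₀ + b' * sin θ * v₁ = 0)
    (h2 : b * π * S' * sin θ * v₀ - b' * cos θ * v₁ = 0) : v₀ = 0 ∧ v₁ = 0 := by
  have hsc := sin_sq_add_cos_sq θ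
  have key : (R' * cos θ + b * π * S') * v₀ = 0 := by
    linear_combination cos θ * h1 + sin θ * h2 - b * π * S' * v₀ * hsc
  have hv0 : v₀ = 0 := by
    rcases mul_eq_zero.1 key with h | h
    · linarith
    · exact h
  subst hv0
  refine ⟨rfl, ?_⟩
  have key2 : b' * v₁ = 0 := by
    linear_combination sin θ * h1 - cos θ * h2 - b' * v₁ * hsc
  rcases mul_eq_zero.1 key2 with h | h
  · exact absurd h hb'
  · exact h

/-! ## Bounds and the two regimes on the parameter box -/

/-- **The two regimes of the tube map on the box `|p₀|, |p₁| < 101/100`**: the width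
`b = (793 + 95 p₁)/500` lies in `(1.39, 1.78)`; `r = R + b sin(π S) > 0`, `r = a(2 - |p₀|)` for `|p₀| ≥ 1/2`
and `r ≥ 3a/2` for `|p₀| ≤ 1/2` (`a = 2/15`), `r ≤ V + b`; and either (legs, `|p₀| ≥ 1/5`) `sin(π S) = 0` with
`cos(π S) = ±1` and `r = R ≤ V`, or (bend, `|p₀| < 1/5`) `V - 1/250 ≤ R ≤ V`. [folklore] -/
theorem tube_regimes {V : ℝ} {R S : ℝ → ℝ} (hReven : ∀ t, R (-t) = R t)
    (hRout : ∀ t, 1 / 2 ≤ |t| → R t = 2 / 15 * (2 - |t|))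
    (hRbend : ∀ t, |t| ≤ 1 / 5 → V - 1 / 250 ≤ R t ∧ R t ≤ V)
    (hRbounds : ∀ t, -2 ≤ t → t ≤ 0 → 2 / 15 * (2 + t) ≤ R t ∧ R t ≤ V)
    (hRmono : StrictMonoOn R (Icc (-2) 0))
    (hS0 : ∀ t, t ≤ -1 / 5 → S t = 0) (hS1 : ∀ t, 1 / 5 ≤ t → S t = 1) (hS01 : ∀ t, 0 ≤ S t ∧ S t ≤ 1)
    {t p : ℝ} (ht : |t| < 101 / 100) (hp : |p| < 101 / 100) :
    139 / 100 < (793 + 95 * p) / 500 ∧ (793 + 95 * p) / 500 < 178 / 100 ∧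
    0 ≤ sin (π * S t) ∧ sin (π * S t) ^ 2 + cos (π * S t) ^ 2 = 1 ∧
    0 < R t + (793 + 95 * p) / 500 * sin (π * S t) ∧
    R t ≤ R t + (793 + 95 * p) / 500 * sin (π * S t) ∧
    R t + (793 + 95 * p) / 500 * sin (π * S t) ≤ V + (793 + 95 * p) / 500 ∧
    2 / 15 * (2 - |t|) ≤ R t ∧ R t ≤ V ∧
    (1 / 2 ≤ |t| → R t + (793 + 95 * p) / 500 * sin (π * S t) = 2 / 15 * (2 - |t|)) ∧
    (|t| ≤ 1 / 2 → 1 / 5 ≤ R t) ∧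
    ((1 / 5 ≤ |t| ∧ sin (π * S t) = 0 ∧ (cos (π * S t) = 1 ∨ cos (π * S t) = -1)) ∨
      (|t| < 1 / 5 ∧ V - 1 / 250 ≤ R t ∧ R t ≤ V)) := by
  have hπ := pi_pos
  obtain ⟨-, -, -, hsin⟩ := cos_pi_mul_sign (hS01 t).1 (hS01 t).2
  have habs := abs_lt.1 ht
  have hpabs := abs_lt.1 hp
  have hb1 : 139 / 100 < (793 + 95 * p) / 500 := by linarith
  have hb2 : (793 + 95 * p) / 500 < 178 / 100 := by linarith
  -- `R` on the box: via the even reflection to `[-2, 0]`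
  have hRt : 2 / 15 * (2 - |t|) ≤ R t ∧ R t ≤ V := by
    rcases le_or_gt 0 t with h | h
    · rw [abs_of_nonneg h, ← hReven]
      have := hRbounds (-t) (by linarith) (by linarith)
      exact ⟨by linarith [this.1], this.2⟩
    · rw [abs_of_neg h]
      have := hRbounds t (by linarith) h.le
      exact ⟨by linarith [this.1], this.2⟩
  have hsin1 : sin (π * S t) ≤ 1 := sin_le_one _
  have hbs : 0 ≤ (793 + 95 * p) / 500 * sin (π * S t) := mul_nonneg (by linarith) hsin
  refine ⟨hb1, hb2, hsin, sin_sq_add_cos_sq _, by nlinarith [hRt.1], by linarith, ?_, hRt.1, hRt.2,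
    fun hhalf => ?_, fun hhalf => ?_, ?_⟩
  · have : (793 + 95 * p) / 500 * sin (π * S t) ≤ (793 + 95 * p) / 500 := by nlinarith
    linarith [hRt.2]
  · -- legs near the ends: `S ∈ {0, 1}`
    have hS : sin (π * S t) = 0 := by
      rcases le_or_gt 0 t with h | h
      · rw [abs_of_nonneg h] at hhalf; rw [hS1 t (by linarith), mul_one, sin_pi]
      · rw [abs_of_neg h] at hhalf; rw [hS0 t (by linarith), mul_zero, sin_zero]
    rw [hS, mul_zero, add_zero, hRout t hhalf]
  · -- the middle: `R ≥ R(∓1/2) = 1/5`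
    have hR12 : R (-(1 / 2)) = 1 / 5 := by
      rw [hRout _ (by rw [abs_neg, abs_of_pos (by norm_num : (0 : ℝ) < 1 / 2)])]; norm_num
    rcases le_or_gt 0 t with h | h
    · rw [abs_of_nonneg h] at hhalf
      rw [← hReven, ← hR12]
      exact hRmono.monotoneOn ⟨by norm_num, by norm_num⟩ ⟨by linarith, by linarith⟩ (by linarith)
    · rw [abs_of_neg h] at hhalf
      rw [← hR12]
      exact hRmono.monotoneOn ⟨by norm_num, by norm_num⟩ ⟨by linarith, h.le⟩ (by linarith)
  · rcases le_or_gt (1 / 5) |t| with h5 | h5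
    · left
      refine ⟨h5, ?_⟩
      rcases le_or_gt 0 t with h | h
      · rw [abs_of_nonneg h] at h5
        rw [hS1 t h5, mul_one, sin_pi, cos_pi]
        exact ⟨rfl, Or.inr rfl⟩
      · rw [abs_of_neg h] at h5
        rw [hS0 t (by linarith), mul_zero, sin_zero, cos_zero]
        exact ⟨rfl, Or.inl rfl⟩
    · right
      exact ⟨h5, hRbend t h5.le⟩

end ModelHandles

/-- **Registered piece `helper_handlebodyChart_modelHandles_planarTube` of the data stub, part 1 (the planar tube
map)**: for profiles `R`, `S` as produced by `helper_handlebodyChart_modelHandles_tubeProfiles` and any positive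
strictly increasing width `b`, the planar tube map `(R + b sin(π S), b cos(π S))` is injective on
`(-2, 2) × (-2, 2)` (`ModelHandles.tube_injective`), and its Jacobian system has trivial kernel wherever
`R' cos(π S) + b π S' > 0` (`ModelHandles.tube_kernel_trivial`). [folklore] -/
theorem helper_handlebodyChart_modelHandles_planarTube : (∀ (R S b : ℝ → ℝ), (∀ t, R (-t) = R t) → StrictMonoOn R (Set.Icc (-2) 0) → (∀ t, t ≤ -1 / 5 → S t = 0) → (∀ t, S (-t) = 1 - S t) → StrictMonoOn S (Set.Icc (-1 / 5) (1 / 5)) → (∀ t, 0 ≤ S t ∧ S t ≤ 1) → StrictMono b → (∀ p, -2 < p → 0 < b p) → ∀ (t t' p p' : ℝ), t ∈ Set.Ioo (-2 : ℝ) 2 → t' ∈ Set.Ioo (-2 : ℝ) 2 → p ∈ Set.Ioo (-2 : ℝ) 2 → p' ∈ Set.Ioo (-2 : ℝ) 2 → R t + b p * Real.sin (Real.pi * S t) = R t' + b p' * Real.sin (Real.pi * S t') → b p * Real.cos (Real.pi * S t) = b p' * Real.cos (Real.pi * S t') → t = t' ∧ p = p') ∧ (∀ (R' S' b b' θ v₀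 v₁ : ℝ), 0 < R' * Real.cos θ + b * Real.pi * S' → b' ≠ 0 → (R' + b * Real.pi * S' * Real.cos θ) * v₀ + b' * Real.sin θ * v₁ = 0 → b * Real.pi * S' * Real.sin θ * v₀ - b' * Real.cos θ * v₁ = 0 → v₀ = 0 ∧ v₁ = 0) :=
  ⟨fun _ _ _ hReven hRmono hS0 hSsymm hSmono hS01 hb hbpos _ _ _ _ ht ht' hp hp' hr hm =>
    ModelHandles.tube_injective hReven hRmono hS0 hSsymm hSmono hS01 hb hbpos ht ht' hp hp' hr hm,
   fun _ _ _ _ _ _ _ hD hb' h1 h2 => ModelHandles.tube_kernel_trivial hD hb' h1 h2⟩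

end Summit.SmoothPoincare4.SmoothPoincare4.Theorems.DcrGap.MkFriends

end
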